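import Summits.Schanuel.Schanuel.Theses.RigidCore
import Literature.NumberTheory.Transcendental.ExpVarieties
import HarnessLib.Audit

/-!
# Line `sweep-below-rank` — skeleton for crux `RigidCore.MinimalCounterexampleInAcl`
(item stmt-Schanuel-0969, route route-Schanuel-RigidCore; idea card
`Cruxes/MinimalCounterexampleInAcl/Ideas/sweep-below-rank.md`, triage TRIAGE-r1-{1,2,3}: pass ×3)

Crux (S*): a first-failure counterexample `x ∈ ℂⁿ` to Schanuel (`x` ℚ-linearly independent,
`trdeg ℚ(x, eˣ) < n`, `SchanuelRank r` for all `r < n`) has every coordinate in a FINITE `∅`-definable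
subset of `ℂ_exp = (ℂ, +, ·, −, 0, 1, exp)`.

Objects (all inlined in the stub signatures so that each stub is self-contained over importable
declarations; the glue uses the abbreviations `locusMates` / `kernelShift` below, definitionally equal to
the inlined text):
* the LOCUS MATES of `x`: `𝓜(x) = {x' | x' ℚ-lin. independent ∧ every p ∈ ℚ[X, Y] vanishing at (x, eˣ)
  vanishes at (x', e^{x'})}` = the ℚ-linearly independent graph points on the ℚ-locus `W` of `(x, eˣ)`;
  `x ∈ 𝓜(x)`;
* kernel shifts `x' + 2πi k`, `k ∈ ℤⁿ`.

The line (one lever: CLOSE THE INTEGER PARAMETER, SWEEP THE TRANSCENDENTAL ONE; the transcendence bill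
is paid by the crux's own hypothesis `SC(<n)`):
* `stub_locusMatesDefinable` (M, provable now — "isolation is free"): `𝓜(x)` is `∅`-definable in `ℂ_exp`
  (`ℤ` is `∅`-definable, `kmo_definable_isInt`; `W` is cut out by finitely many integer polynomials). With
  `𝓜(x)` FINITE, each coordinate projection is a finite `∅`-definable set containing `x i` (glue
  `mem_acl_of_finite`). So the crux follows from FIRST-FAILURE SPARSITY `𝓜(x).Finite` (the transfer C⁺).
* `𝓜(x).Finite` ⟸ (every kernel class `𝓜(x) ∩ (x' + 2πiℤⁿ)` is finite) ∧ (the exponential image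
  `exp(𝓜(x))` is finite) — glue `mates_finite` (two mates with the same exponentials differ by a kernel
  shift, `Complex.exp_eq_exp_iff_exists_int`).
* KERNEL CLASSES ARE FINITE (the card's K1 `BranchFiniteness`, all ranks) = glue `branch_finite` over three
  stubs: `stub_spread` (L: spreading in LOCUS form — an infinite kernel class sits, after one shift `k₁`,
  inside ONE irreducible component `X` of the fibre `W_{y'}`, `y' = e^{x'}`, defined over the algebraically
  closed field `K = ℚ(y')^alg ∩ ℂ`… `K ⊆ ℂ` relatively algebraically closed, with the FREE inequality
  `dim X ≤ trdeg_K K(x' + 2πik₁, 2πi)` from mate genericity + additivity of trdeg — no fibre-dimension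
  theorem needed), `stub_structureLemma` (XL, pure algebraic geometry — THE LEVER, stated relative to an
  arbitrary infinite `D` as triage r1-1 asked: a `K`-variety `X` of dimension `≤ trdeg_K K(ℓ, c)` containing
  `ℓ + ck` for infinitely many `k ∈ D ⊆ ℤⁿ` contains a RATIONAL-direction affine subspace `N` of codimension
  `m < n` through some `ℓ + ck₀`, `k₀ ∈ D`, meeting `ℓ + cD` infinitely often), `stub_endgame` (L: a
  rational affine subspace of codimension `m < n` through a MATE inside the fibre of the first-failure
  locus is a rank-`m` Schanuel counterexample `κ = q·x*` — `trdeg ℚ(κ, e^κ) ≤ m − 1` by the embedding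
  `Z × V ↪ W` — killed by `SchanuelRank m`, `m < n`).
* EXPONENTIAL IMAGE FINITE: on the LOG SECTOR (all `e^{x_i}` algebraic) this is PROVED here (glue
  `expImage_finite_of_algebraic`: exponentials of mates are among the conjugates of `eˣ`), so on that
  sector the crux closes modulo the four provable stubs (card K2: "(S*) holds for logarithms of algebraic
  numbers at every rank"); OFF the log sector it is the registered residue `stub_expImageFinite_offLog`
  (OPEN — hardest stub: at `n = 2` it is the Shapiro/Dirichlet-atom finiteness of `SparsityTwo` restricted
  to first-failure loci, with the branch direction removed).
`MinimalCounterexampleInAcl_of` concludes the crux BY NAME from the five stubs; everything under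
`## Glue` is sorry-free.

Disproof obligations honoured (cdisprove gen2 v11, evidence `…-Disproof.lean` on stmt-Schanuel-0969; not
mounted in this jail — its eleven evidence notes were used; no `Negative/` lemma has landed for this crux):
`not_withoutTrdeg` (trdeg bound essential) — consumed in `stub_spread` (tightness `dim W = n − 1`) and
`stub_endgame` (`dim W ≤ n − 1`); `not_withoutLinIndep_of_schanuelRank_two` — consumed in `stub_endgame`
(`κ = q·x*` is ℚ-independent because the mate `x*` is) and in the definition of mates;
`withoutFirstFailure_defectLeOne` (first-failure essential) — `SchanuelRank m`, `m < n`, is THE input of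
`stub_endgame` and `SchanuelRank (n−1)` gives mate genericity in `stub_spread`; `uniformVersion_iff_schanuel`
— the finite definable set produced here is `pr_i 𝓜(x)` and depends on `x` (no uniformity claimed);
`countableVersion_holds` / `crux_iff_eclVersion` — consistent (we prove finiteness of a set already known
countable). `ledger negatives --problem Schanuel`: 2 PolarPhantoms refutations, unrelated; no stub is an
instance of either.
-/

noncomputable section

set_option linter.dupNamespace false
set_option linter.unusedVariables false

open Set Complex FirstOrder
open Literature.ModelTheory.ExponentialFields Literature.NumberTheory.Transcendental

namespace Summit.Schanuel.Schanuel.Cruxes.MinimalCounterexampleInAcl.SweepBelowRank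

/-! ## Stubs (the registered open lemmas of the line; each signature is self-contained) -/

/-- **Stub 1 — locus mates are `∅`-definable ("definable isolation is free"; provable now, size M).**
For ANY `x ∈ ℂⁿ`, the set of ℚ-linearly independent `x'` such that `(x', e^{x'})` satisfies every
ℚ-polynomial relation of `(x, eˣ)` is `∅`-definable in `(ℂ, +, ·, −, 0, 1, exp)` as an `n`-ary relation.
Plan: the relations form the ideal `I ⊆ ℚ[X, Y]` of `(x, eˣ)`, finitely generated (Hilbert basis,
`MvPolynomial.isNoetherianRing`; so the `∀ p` is a finite conjunction, `Set.definable_finset_inf`), and after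
clearing denominators each generator is an `L_exp`-term with integer numerals, `exp` a function symbol (tree:
`definableFun_cexp`, `definableFun_expRing_mul`, `definable_setOf_eq_params`, `definableFun_proj_params` in
`Literature.ModelTheory.ExponentialFields.KMOPointwiseDefinableProofs`; Mathlib `DefinableFun.setOf_eq`);
ℚ-linear DEPENDENCE is `∃ m₁ … m_n, (∀ i, m_i ∈ ℤ) ∧ (∃ i, m_i ≠ 0) ∧ Σ m_i x'_i = 0` with
`ℤ = {m | ∀ z, e^z = 1 → e^{mz} = 1}` `∅`-definable (`kmo_definable_isInt`, `kmo_isInt_iff`), then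
`Set.Definable.exists_of_finite` / `.compl` / `.preimage_comp`. Sources: KMO arXiv:1101.4224 §2.1–2.2; cards
isolation-is-free / kernel-arithmetic-selection (merged by triage; lemma `LinearIndependentDefinable`). -/
theorem stub_locusMatesDefinable (n : ℕ) (x : Fin n → ℂ) :
    Set.Definable (∅ : Set ℂ) Literature.ModelTheory.ExponentialFields.Language.expRing
      {x' : Fin n → ℂ | LinearIndependent ℚ x' ∧
        ∀ p : MvPolynomial (Fin n ⊕ Fin n) ℚ,
          MvPolynomial.aeval (Sum.elim x (Complex.exp ∘ x)) p = 0 →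
          MvPolynomial.aeval (Sum.elim x' (Complex.exp ∘ x')) p = 0} := by
  sorry

/-- **Stub 2 — spreading in locus form (the set-up of the sweep; provable now, size L).**
Let `x` be a first failure at rank `n`, `x'` a locus mate of `x`, and suppose infinitely many kernel shifts
`x' + 2πik` are again locus mates. Then there are: a subfield `K ⊆ ℂ` containing `ℚ` and relatively
algebraically closed in `ℂ` (take `K :=` the algebraic closure of `ℚ(e^{x'})` inside `ℂ`), an irreducible
closed `X ⊆ ℂⁿ` defined over `K` (an irreducible component of the fibre `{z | (z, e^{x'}) ∈ W}` of the
ℚ-locus `W` of `(x, eˣ)` containing infinitely many of the shifts — finitely many components, pigeonhole),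
a bound `d ≥ dim X`, and one shift `k₁` with `x' + 2πik₁ ∈ X`, such that
(i) `d ≤ trdeg_K K(x' + 2πik₁, 2πi)` — FREE in locus form: `ℓ := x' + 2πik₁` is a mate, hence
(`SchanuelRank (n−1)` on `n−1` of its coordinates + `trdeg < n`) ℚ-generic on `W` with
`trdeg ℚ(ℓ, y') = n − 1 = dim W`, while a `K`-generic point `z₀` of `X` has `(z₀, y') ∈ W`, so
`dim X + trdeg ℚ(y') = trdeg ℚ(z₀, y') ≤ dim W = trdeg ℚ(y') + trdeg_K K(ℓ)` (additivity of trdeg in towers,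
`K` algebraic over `ℚ(y')`); (ii) every point of `X` lies in the fibre: `p(z, e^{x'}) = 0` for all `p ∈ I`;
(iii) infinitely many shifts of `ℓ` lie in `X` and are mates.
Uses `not_withoutTrdeg` / first-failure tightness (Disproof `firstFailure_trdeg_eq`). Leans on (tree, PROVED):
`Literature.AlgebraicGeometry.Resolution.exists_ringKrullDim_eq_and_trdeg_eq` (dim of an affine domain = trdeg,
Matsumura Thm 5.6), `trdeg_eq_trdeg_of_isFractionRing`, `ringKrullDim_le_of_trdeg_le`; Mathlib
`Algebra.trdeg_add_eq` (towers, stacks 030H), `IsTranscendenceBasis`, `minpoly`; tree `zariskiDim`,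
`IsDefinedOver.isZariskiClosed`, `zariskiDim_mono`. Gaps a prover must bridge: irreducible components of a
`K`-closed set over an algebraically closed subfield `K ⊆ ℂ` are `K`-closed; `zariskiDim` of the ℚ-locus of a
point = `trdeg` of the point. Sources: card sweep-below-rank (Why it bites (ii)); Kirby arXiv:0810.4285
Prop 7.2 (locus set-up); Marker2006 §1; Matsumura1987 Thm 5.6. -/
theorem stub_spread (n : ℕ) (x : Fin n → ℂ) (hx : LinearIndependent ℚ x)
    (htr : Algebra.trdeg ℚ ↥(IntermediateField.adjoin ℚ (Set.range x ∪ Set.range (Complex.exp ∘ x))) <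
      (n : Cardinal))
    (hSR : ∀ r < n, Literature.NumberTheory.Transcendental.SchanuelRank r)
    (x' : Fin n → ℂ)
    (hx' : x' ∈ {x' : Fin n → ℂ | LinearIndependent ℚ x' ∧
        ∀ p : MvPolynomial (Fin n ⊕ Fin n) ℚ,
          MvPolynomial.aeval (Sum.elim x (Complex.exp ∘ x)) p = 0 →
          MvPolynomial.aeval (Sum.elim x' (Complex.exp ∘ x')) p = 0})
    (hD : {k : Fin n → ℤ | (fun i => x' i + 2 * ↑Real.pi * Complex.I * (k i : ℂ)) ∈
        {x' : Fin n → ℂ | LinearIndependent ℚ x' ∧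
          ∀ p : MvPolynomial (Fin n ⊕ Fin n) ℚ,
            MvPolynomial.aeval (Sum.elim x (Complex.exp ∘ x)) p = 0 →
            MvPolynomial.aeval (Sum.elim x' (Complex.exp ∘ x')) p = 0}}.Infinite) :
    ∃ (K : IntermediateField ℚ ℂ) (X : Set (Fin n → ℂ)) (d : ℕ) (k₁ : Fin n → ℤ),
      (∀ w : ℂ, IsAlgebraic K w → w ∈ K) ∧
      Literature.NumberTheory.Transcendental.IsIrreducibleClosed ℂ X ∧
      Literature.NumberTheory.Transcendental.IsDefinedOver K.toSubfield X ∧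
      Literature.NumberTheory.Transcendental.zariskiDim ℂ X ≤ d ∧
      (d : Cardinal) ≤ Algebra.trdeg K ↥(IntermediateField.adjoin K
        (insert (2 * ↑Real.pi * Complex.I)
          (Set.range fun i => x' i + 2 * ↑Real.pi * Complex.I * (k₁ i : ℂ)))) ∧
      (∀ z ∈ X, ∀ p : MvPolynomial (Fin n ⊕ Fin n) ℚ,
          MvPolynomial.aeval (Sum.elim x (Complex.exp ∘ x)) p = 0 →
          MvPolynomial.aeval (Sum.elim z (Complex.exp ∘ x')) p = 0) ∧
      {k : Fin n → ℤ |
        (fun i => (x' i + 2 * ↑Real.pi * Complex.I * (k₁ i : ℂ)) + 2 * ↑Real.pi * Complex.I * (k i : ℂ))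
            ∈ X ∧
        (fun i => (x' i + 2 * ↑Real.pi * Complex.I * (k₁ i : ℂ)) + 2 * ↑Real.pi * Complex.I * (k i : ℂ))
            ∈ {x' : Fin n → ℂ | LinearIndependent ℚ x' ∧
                ∀ p : MvPolynomial (Fin n ⊕ Fin n) ℚ,
                  MvPolynomial.aeval (Sum.elim x (Complex.exp ∘ x)) p = 0 →
                  MvPolynomial.aeval (Sum.elim x' (Complex.exp ∘ x')) p = 0}}.Infinite := by
  sorry

/-- **Stub 3 — the STRUCTURE LEMMA (the sweep; pure algebraic geometry, provable in principle, size XL —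
the lever of the line, stated relative to an arbitrary infinite `D` as triage r1-1 sharpened it).**
`K ⊆ ℂ` relatively algebraically closed, `X ⊆ ℂⁿ` irreducible closed defined over `K` with `dim X ≤ d`,
`ℓ ∈ ℂⁿ`, `c ≠ 0` with `d ≤ trdeg_K K(ℓ, c)`, and `D ⊆ ℤⁿ` infinite with `ℓ + ck ∈ X` for all `k ∈ D`.
Then there are `m < n` ℚ-linearly independent rational forms `q₁ … q_m` and `k₀ ∈ D` such that the
rational-direction affine subspace `N = {z | ∀ j, q_j·z = q_j·(ℓ + ck₀)}` lies in `X` and contains `ℓ + ck`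
for infinitely many `k ∈ D` (`m = 0`: `X = ℂⁿ`).
Plan (card + the three triage re-derivations): `A :=` ℚ-Zariski closure of `D` (defined over ℚ);
`X ⊇ ℓ + cA`; the closed `Aut(ℂ/K)`-invariant condition `ℓ' + c'A ⊆ X` holds on the `K`-locus `Λ ∋ (ℓ, c)`,
`dim Λ = trdeg_K K(ℓ, c) ≥ d ≥ dim X`; fibres of `Ψ : Λ × A → X` have `dim ≥ dim A`, and a fibre through a
general `z` is `⋃_a Λ ∩ {(z − sa, s)}`: either a punctured line lies in `Λ` (the cone `z + ℂ(A − a) ⊆ X`) or a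
dense set of `a` occurs; either way `T_z X ⊇ dir AffSpan_ℚ(A)` (char-0 Gauss-map lemma), so `X = ℂⁿ` unless
`AffSpan_ℚ(A)` is a proper RATIONAL affine subspace `{q_j·k = r_j}`; then pass to the `K(κ)`-generic fibre
over `κ_j = q_j·ℓ + c r_j` (the invariant `trdeg ≥ dim` is hereditary) and recurse in the smaller ambient
space. Checks survived: `n = 2` (an irreducible `K`-curve with a positive-dimensional family of affine-scalar
symmetries is a rational line: reproves route supports 0974/0975 from Hermite–Lindemann WITHOUT Baker),
`c ∈ K`, the twisted cubic in a quadric (`n = 3`; triage kit jobs j007412/j007435), parabola/Pell/cone.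
Why it might fail: an off-by-one in the recursion (generic-fibre equidimensionality, Gauss map at singular
points); formal cost real (no fibre-dimension / constructibility API in Mathlib).
Sources: card sweep-below-rank; card period-lattice-rigidity-baker (Conjecture L∞, refuter-triage-16
transporter note); Bombieri–Masser–Zannier / Pila 2022 Ch. 13–15 (closure of rational points is ℚ-closed;
spread the transcendental parameter over its locus). -/
theorem stub_structureLemma (n d : ℕ) (K : IntermediateField ℚ ℂ)
    (hK : ∀ w : ℂ, IsAlgebraic K w → w ∈ K)
    (X : Set (Fin n → ℂ)) (hXirr : Literature.NumberTheory.Transcendental.IsIrreducibleClosed ℂ X)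
    (hXdef : Literature.NumberTheory.Transcendental.IsDefinedOver K.toSubfield X)
    (hXdim : Literature.NumberTheory.Transcendental.zariskiDim ℂ X ≤ d)
    (ℓ : Fin n → ℂ) (c : ℂ) (hc : c ≠ 0)
    (ht : (d : Cardinal) ≤ Algebra.trdeg K ↥(IntermediateField.adjoin K (insert c (Set.range ℓ))))
    (D : Set (Fin n → ℤ)) (hDX : ∀ k ∈ D, (fun i => ℓ i + c * (k i : ℂ)) ∈ X) (hD : D.Infinite) :
    ∃ (m : ℕ) (q : Fin m → Fin n → ℚ) (k₀ : Fin n → ℤ), m < n ∧ LinearIndependent ℚ q ∧ k₀ ∈ D ∧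
      {z : Fin n → ℂ | ∀ j, ∑ i, (q j i : ℂ) * z i = ∑ i, (q j i : ℂ) * (ℓ i + c * (k₀ i : ℂ))} ⊆ X ∧
      {k ∈ D | ∀ j, ∑ i, (q j i : ℂ) * (k i : ℂ) = ∑ i, (q j i : ℂ) * (k₀ i : ℂ)}.Infinite := by
  sorry

/-- **Stub 4 — the ENDGAME: a rational affine subspace through a mate inside the fibre of a first-failure
locus is a SMALLER Schanuel counterexample (provable now, size L; this is where `SC(<n)` is spent).**
`x` a first failure at rank `n`; `m < n`; `q₁ … q_m` ℚ-linearly independent rational forms; `x*` a locus mate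
of `x`; and every `z` with `q_j·z = q_j·x*` for all `j` has `(z, e^{x*})` on the ℚ-locus `W` of `(x, eˣ)`.
Then `False`.
Plan: `κ_j := q_j·x*` is a ℚ-independent `m`-tuple (independence of `x*` and of the `q_j`);
`e^{N₀κ_j} = ∏ (e^{x*_i})^{Q_ji} ∈ ℚ(y*)`, `y* = e^{x*}`, so `e^κ` is algebraic over `ℚ(y*)`; the condition
`s(κ'') + V ⊆ W_{y''}` (`V = ⋂ ker q_j`, `s` a rational section of `q`) is ℚ-closed in `(κ'', y'')`, hence holds
on the ℚ-locus `Z` of `(κ, y*)`, and `(κ'', y'', v) ↦ (s(κ'') + v, y'')` embeds `Z × V` into `W`: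
`trdeg ℚ(κ, y*) + (n − m) ≤ dim W ≤ n − 1`, i.e. `trdeg ℚ(κ, e^κ) ≤ trdeg ℚ(κ, y*) ≤ m − 1 < m` — contradicting
`SchanuelRank m` (`m < n`); for `m = 0` the dimension count itself is absurd. Honours `not_withoutLinIndep…`
and `withoutFirstFailure_defectLeOne` (both hypotheses are consumed here). Leans on (tree, PROVED):
`Literature.AlgebraicGeometry.Resolution.exists_ringKrullDim_eq_and_trdeg_eq`, `ringKrullDim_le_of_trdeg_le`;
Mathlib `Algebra.trdeg_add_eq`, `trdeg_eq_zero` (algebraic extensions), `LinearIndependent`, `Matrix.rank`;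
tree `SchanuelRank`, `zariskiDim_mono`. Gaps: `zariskiDim` of a ℚ-locus = `trdeg` of its generic point (or run
the whole count with `trdeg` of points, avoiding `zariskiDim`); invariance of dimension under injective linear maps.
Sources: card sweep-below-rank (endgame, checked on paper by TRIAGE-r1-1/2/3); Roy2001 Conj. 1
(`SchanuelRank`); Lang 1966 pp. 30–31; Matsumura1987 Thm 5.6. -/
theorem stub_endgame (n : ℕ) (x : Fin n → ℂ) (hx : LinearIndependent ℚ x)
    (htr : Algebra.trdeg ℚ ↥(IntermediateField.adjoin ℚ (Set.range x ∪ Set.range (Complex.exp ∘ x))) <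
      (n : Cardinal))
    (hSR : ∀ r < n, Literature.NumberTheory.Transcendental.SchanuelRank r)
    (m : ℕ) (hm : m < n) (q : Fin m → Fin n → ℚ) (hq : LinearIndependent ℚ q)
    (xs : Fin n → ℂ)
    (hxs : xs ∈ {x' : Fin n → ℂ | LinearIndependent ℚ x' ∧
        ∀ p : MvPolynomial (Fin n ⊕ Fin n) ℚ,
          MvPolynomial.aeval (Sum.elim x (Complex.exp ∘ x)) p = 0 →
          MvPolynomial.aeval (Sum.elim x' (Complex.exp ∘ x')) p = 0})
    (hN : ∀ z : Fin n → ℂ, (∀ j, ∑ i, (q j i : ℂ) * z i = ∑ i, (q j i : ℂ) * xs i) →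
        ∀ p : MvPolynomial (Fin n ⊕ Fin n) ℚ,
          MvPolynomial.aeval (Sum.elim x (Complex.exp ∘ x)) p = 0 →
          MvPolynomial.aeval (Sum.elim z (Complex.exp ∘ xs)) p = 0) :
    False := by
  sorry

/-- **Stub 5 — the RESIDUE: finiteness of the exponential image off the log sector (OPEN; the hardest
stub).** For a first failure `x` at rank `n` with SOME `e^{x_i}` transcendental, the locus mates of `x` have
only finitely many exponential images `e^{x'}` — i.e. only finitely many points `y'` of the `y`-projection
of the ℚ-locus `W` carry a ℚ-linearly independent logarithm vector on `W`. (On the log sector — all `e^{x_i}`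
algebraic — this is PROVED below, `expImage_finite_of_algebraic`.) Status: open; irrefutable short of an
`SC(n)` counterexample (hypotheses inconsistent under Schanuel); at `n = 2` (`trdeg = 1`, Disproof
`rankTwo_trdeg_eq_one`) it is the Shapiro/Dirichlet-atom finiteness of the sibling crux `SparsityTwo`
(stmt-Schanuel-0971) restricted to first-failure curves, WITH THE BRANCH DIRECTION REMOVED by Stubs 2–4:
known pieces — non-Γ-symmetric curves by o-minimal modulus splitting (card modulus-first-certification),
real-quadratic slope with torsion phases (pell-orbit-analyticity-shapiro Thm P), polylog counting off
`{q·x = 0}` (BNZ arXiv:2202.05305); conditional in general (Shapiro from SC: D'Aquino–Macintyre–Terzo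
arXiv:1206.6747 §5, Fischler–Rivoal arXiv:2503.20345 Thm 1.7). The sweep itself extends to TORSION shifts
`x' + 2πiv`, `v ∈ ℚⁿ` (card P1, Laurent 1984 / Manin–Mumford for tori) — a strengthening of Stubs 2–4 that
would weaken this stub to finiteness modulo roots of unity; not claimed here.
Why it might fail: only together with Schanuel (a counterexample is `¬ SC(n)`); what may fail is
PROVABILITY — barrier `AlgebraicIndependenceOfLogarithms` prices the non-torsion-phase atoms as
linear-forms-in-three-logarithms with exponent 1. Sources: arXiv:1206.6747, arXiv:2503.20345,
arXiv:2202.05305, cards pell-orbit-analyticity-shapiro / sparse-sheets-wilkie-counting. -/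
theorem stub_expImageFinite_offLog (n : ℕ) (x : Fin n → ℂ) (hx : LinearIndependent ℚ x)
    (htr : Algebra.trdeg ℚ ↥(IntermediateField.adjoin ℚ (Set.range x ∪ Set.range (Complex.exp ∘ x))) <
      (n : Cardinal))
    (hSR : ∀ r < n, Literature.NumberTheory.Transcendental.SchanuelRank r)
    (hoff : ∃ i, Transcendental ℚ (Complex.exp (x i))) :
    ((fun x' : Fin n → ℂ => Complex.exp ∘ x') ''
      {x' : Fin n → ℂ | LinearIndependent ℚ x' ∧
        ∀ p : MvPolynomial (Fin n ⊕ Fin n) ℚ,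
          MvPolynomial.aeval (Sum.elim x (Complex.exp ∘ x)) p = 0 →
          MvPolynomial.aeval (Sum.elim x' (Complex.exp ∘ x')) p = 0}).Finite := by
  sorry

/-! ## Glue (sorry-free) -/

/-- The locus mates of `x` (glue abbreviation; definitionally the set-builder inlined in the stubs): the
ℚ-linearly independent `x'` with `(x', e^{x'})` on the ℚ-locus of `(x, eˣ)`. -/
def locusMates (n : ℕ) (x : Fin n → ℂ) : Set (Fin n → ℂ) :=
  {x' : Fin n → ℂ | LinearIndependent ℚ x' ∧
    ∀ p : MvPolynomial (Fin n ⊕ Fin n) ℚ,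
      MvPolynomial.aeval (Sum.elim x (Complex.exp ∘ x)) p = 0 →
      MvPolynomial.aeval (Sum.elim x' (Complex.exp ∘ x')) p = 0}

/-- The kernel shift `x' + 2πi k` (glue abbreviation; definitionally the lambda inlined in the stubs). -/
def kernelShift {n : ℕ} (x' : Fin n → ℂ) (k : Fin n → ℤ) : Fin n → ℂ :=
  fun i => x' i + 2 * ↑Real.pi * Complex.I * (k i : ℂ)

theorem mem_locusMates_self {n : ℕ} {x : Fin n → ℂ} (hx : LinearIndependent ℚ x) :
    x ∈ locusMates n x :=
  ⟨hx, fun _ hp => hp⟩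

/-- Two tuples with the same exponentials differ by a kernel shift. -/
theorem eq_kernelShift_of_exp_eq {n : ℕ} {x₀ x' : Fin n → ℂ}
    (h : Complex.exp ∘ x' = Complex.exp ∘ x₀) : ∃ k : Fin n → ℤ, x' = kernelShift x₀ k := by
  have hk : ∀ i, ∃ k : ℤ, x' i = x₀ i + k * (2 * ↑Real.pi * Complex.I) := fun i =>
    Complex.exp_eq_exp_iff_exists_int.1 (congrFun h i)
  choose k hk using hk
  refine ⟨k, funext fun i => ?_⟩
  rw [hk i, kernelShift]
  ring

/-- **Kernel classes are finite (BranchFiniteness, card K1, all ranks).** For a first failure `x` and a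
locus mate `x'`, only finitely many kernel shifts `x' + 2πik` are locus mates — from Stubs 2, 3, 4:
spread, sweep, and read the rational affine subspace as a counterexample below rank `n`. -/
theorem branch_finite {n : ℕ} {x : Fin n → ℂ} (hx : LinearIndependent ℚ x)
    (htr : Algebra.trdeg ℚ ↥(IntermediateField.adjoin ℚ (Set.range x ∪ Set.range (Complex.exp ∘ x))) <
      (n : Cardinal))
    (hSR : ∀ r < n, SchanuelRank r) {x' : Fin n → ℂ} (hx' : x' ∈ locusMates n x) :
    {k : Fin n → ℤ | kernelShift x' k ∈ locusMates n x}.Finite := by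
  by_contra hinf
  -- Stub 2: spread — one component `X` of the fibre, over `K`, with the free inequality
  obtain ⟨K, X, d, k₁, hK, hXirr, hXdef, hXdim, ht, hXfib, hD⟩ :=
    stub_spread n x hx htr hSR x' hx' hinf
  have hc : (2 * ↑Real.pi * Complex.I : ℂ) ≠ 0 :=
    mul_ne_zero (mul_ne_zero two_ne_zero (Complex.ofReal_ne_zero.2 Real.pi_ne_zero)) Complex.I_ne_zero
  -- Stub 3: sweep — a rational affine subspace of `X` through a surviving mate
  -- (the application is staged so that `ℓ`, `c`, `D` are elaborated before the big types are unified)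
  have h1 := stub_structureLemma n d K hK X hXirr hXdef hXdim
  have h2 := h1 (fun i => x' i + 2 * ↑Real.pi * Complex.I * (k₁ i : ℂ)) (2 * ↑Real.pi * Complex.I) hc
  have h3 := h2 ht
  have h4 := h3
    {k : Fin n → ℤ |
      (fun i => (x' i + 2 * ↑Real.pi * Complex.I * (k₁ i : ℂ)) + 2 * ↑Real.pi * Complex.I * (k i : ℂ))
          ∈ X ∧
      (fun i => (x' i + 2 * ↑Real.pi * Complex.I * (k₁ i : ℂ)) + 2 * ↑Real.pi * Complex.I * (k i : ℂ))
          ∈ locusMates n x}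
  obtain ⟨m, q, k₀, hm, hq, hk₀, hN, -⟩ := h4 (fun k hk => hk.1) hD
  -- the surviving mate `xs = x' + 2πi(k₁ + k₀)` has the same exponentials as `x'`
  have hexp : (Complex.exp ∘ fun i =>
      (x' i + 2 * ↑Real.pi * Complex.I * (k₁ i : ℂ)) + 2 * ↑Real.pi * Complex.I * (k₀ i : ℂ)) =
      Complex.exp ∘ x' := by
    funext i
    simp only [Function.comp_apply]
    rw [show x' i + 2 * ↑Real.pi * Complex.I * (k₁ i : ℂ) + 2 * ↑Real.pi * Complex.I * (k₀ i : ℂ) =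
        x' i + ((k₁ i + k₀ i : ℤ) : ℂ) * (2 * ↑Real.pi * Complex.I) by push_cast; ring,
      Complex.exp_add, Complex.exp_int_mul_two_pi_mul_I, mul_one]
  -- Stub 4: endgame — that subspace is a Schanuel counterexample of rank `m < n`
  have h5 := stub_endgame n x hx htr hSR m hm q hq
    (fun i => (x' i + 2 * ↑Real.pi * Complex.I * (k₁ i : ℂ)) + 2 * ↑Real.pi * Complex.I * (k₀ i : ℂ))
  refine h5 hk₀.2 ?_
  intro z hz p hp
  rw [hexp]
  exact hXfib z (hN hz) p hp

/-- **First-failure sparsity from the two finiteness statements.** If every kernel class of mates is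
finite and the exponential image of the mates is finite, the mates are finite: two mates with the same
exponentials differ by a kernel shift. -/
theorem mates_finite_of {n : ℕ} {x : Fin n → ℂ}
    (hE : ((fun x' : Fin n → ℂ => Complex.exp ∘ x') '' locusMates n x).Finite)
    (hB : ∀ x' ∈ locusMates n x, {k : Fin n → ℤ | kernelShift x' k ∈ locusMates n x}.Finite) :
    (locusMates n x).Finite := by
  have hcover : locusMates n x ⊆
      ⋃ y ∈ (fun x' : Fin n → ℂ => Complex.exp ∘ x') '' locusMates n x,
        {x' ∈ locusMates n x | Complex.exp ∘ x' = y} := by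
    intro x' hx'
    simp only [Set.mem_iUnion, Set.mem_setOf_eq, exists_prop]
    exact ⟨Complex.exp ∘ x', ⟨x', hx', rfl⟩, hx', rfl⟩
  refine Set.Finite.subset (Set.Finite.biUnion hE fun y hy => ?_) hcover
  obtain ⟨x₀, hx₀, rfl⟩ := hy
  refine ((hB x₀ hx₀).image fun k => kernelShift x₀ k).subset ?_
  rintro x' ⟨hx'M, hx'exp⟩
  obtain ⟨k, rfl⟩ := eq_kernelShift_of_exp_eq hx'exp
  exact ⟨k, hx'M, rfl⟩

/-- **The log sector needs no residue (card K2).** If every `e^{x_i}` is algebraic, the exponentials of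
the locus mates of `x` are coordinatewise roots of the minimal polynomials of the `e^{x_i}` — finitely
many. (No first-failure hypothesis is needed.) -/
theorem expImage_finite_of_algebraic {n : ℕ} {x : Fin n → ℂ}
    (halg : ∀ i, IsAlgebraic ℚ (Complex.exp (x i))) :
    ((fun x' : Fin n → ℂ => Complex.exp ∘ x') '' locusMates n x).Finite := by
  classical
  have key : ∀ x' ∈ locusMates n x, ∀ i,
      Complex.exp (x' i) ∈ (minpoly ℚ (Complex.exp (x i))).rootSet ℂ := by
    intro x' hx' i
    have hne : minpoly ℚ (Complex.exp (x i)) ≠ 0 := minpoly.ne_zero (halg i).isIntegral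
    rw [Polynomial.mem_rootSet_of_ne hne]
    have h := hx'.2
      (Polynomial.aeval (MvPolynomial.X (Sum.inr i) : MvPolynomial (Fin n ⊕ Fin n) ℚ)
        (minpoly ℚ (Complex.exp (x i)))) (by
        rw [← Polynomial.aeval_algHom_apply, MvPolynomial.aeval_X]
        simp [minpoly.aeval])
    rw [← Polynomial.aeval_algHom_apply, MvPolynomial.aeval_X] at h
    simpa using h
  refine (Set.Finite.pi' fun i : Fin n => Polynomial.rootSet_finite (minpoly ℚ (Complex.exp (x i))) ℂ).subset
    ?_
  rintro _ ⟨x', hx', rfl⟩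
  exact fun i => key x' hx' i

/-- **Definable isolation is free (glue over Stub 1).** If the locus mates of `x` form a finite set, every
coordinate `x i` lies in a finite `∅`-definable subset of `ℂ_exp`: the `i`-th coordinate projection of the
mates (finite projections of definable sets are definable, `Set.Definable.image_comp`). -/
theorem mem_acl_of_finite {n : ℕ} {x : Fin n → ℂ} (hx : LinearIndependent ℚ x)
    (hfin : (locusMates n x).Finite) (i : Fin n) :
    ∃ s : Set ℂ, s.Finite ∧ Set.Definable₁ (∅ : Set ℂ) Language.expRing s ∧ x i ∈ s := by
  refine ⟨(fun v : Fin n → ℂ => v i) '' locusMates n x, hfin.image _, ?_,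
    ⟨x, mem_locusMates_self hx, rfl⟩⟩
  have hdef : Set.Definable (∅ : Set ℂ) Language.expRing (locusMates n x) :=
    stub_locusMatesDefinable n x
  have himg := hdef.image_comp (fun _ : Fin 1 => i)
  unfold Set.Definable₁
  convert himg using 1
  ext v
  simp only [Set.mem_setOf_eq, Set.mem_image]
  constructor
  · rintro ⟨w, hw, hwi⟩
    refine ⟨w, hw, funext fun j => ?_⟩
    rw [Subsingleton.elim j 0]
    simpa using hwi
  · rintro ⟨w, hw, rfl⟩
    exact ⟨w, hw, rfl⟩

/-- **The composition (concludes the crux BY NAME).** For a first failure `x`: kernel classes of mates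
are finite (Stubs 2–4 via `branch_finite`), the exponential image is finite (proved on the log sector,
Stub 5 off it), so the mates are finite (`mates_finite_of`), so each `x i` lies in the finite `∅`-definable
`i`-th projection of the mates (Stub 1 via `mem_acl_of_finite`). -/
theorem MinimalCounterexampleInAcl_of :
    Summit.Schanuel.Schanuel.Theses.RigidCore.MinimalCounterexampleInAcl := by
  intro n x hx htr hSR i
  have hB : ∀ x' ∈ locusMates n x, {k : Fin n → ℤ | kernelShift x' k ∈ locusMates n x}.Finite :=
    fun x' hx' => branch_finite hx htr hSR hx'
  have hE : ((fun x' : Fin n → ℂ => Complex.exp ∘ x') '' locusMates n x).Finite := by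
    by_cases halg : ∀ j, IsAlgebraic ℚ (Complex.exp (x j))
    · exact expImage_finite_of_algebraic halg
    · push Not at halg
      exact stub_expImageFinite_offLog n x hx htr hSR halg
  exact mem_acl_of_finite hx (mates_finite_of hE hB) i

end Summit.Schanuel.Schanuel.Cruxes.MinimalCounterexampleInAcl.SweepBelowRank

end
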